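import Mathlib

/-!
# VisibilitySketch — the Atkin–Lehner sign trick behind the visibility law (CENSUS-packet-visibility §3.1)

Pure lattice algebra, no modular input: over a commutative ring `R` in which `2` is a unit, a module `M`
with an involution `W` (think: `W_Q` acting on `H₁(X₀(N), ℤ_p)`, on the Néron cotangent lattice, or on `T_p J`,
`p` odd) is the direct sum of the `W = 1` and `W = -1` parts, and every `W`-stable submodule splits accordingly.
Consequence used in the census: a congruence between `f` and a packet member of opposite `W_Q`-sign is invisible
to `deg φ_E` and to `t_f(Λ)`.
-/

namespace Summit.BirchSwinnertonDyer.BirchSwinnertonDyer.Cruxes.EisensteinAdditiveManinResidual.Visibility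

open LinearMap

variable {R M : Type*} [CommRing R] [AddCommGroup M] [Module R M]

/-- The `+1` part of an endomorphism `W`. -/
def plusPart (W : M →ₗ[R] M) : Submodule R M := LinearMap.ker (W - 1)

/-- The `-1` part of an endomorphism `W`. -/
def minusPart (W : M →ₗ[R] M) : Submodule R M := LinearMap.ker (W + 1)

lemma mem_plusPart {W : M →ₗ[R] M} {x : M} : x ∈ plusPart W ↔ W x = x := by
  simp [plusPart, sub_eq_zero]

lemma mem_minusPart {W : M →ₗ[R] M} {x : M} : x ∈ minusPart W ↔ W x = -x := by
  simp [minusPart, eq_neg_iff_add_eq_zero]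

/-- If `W ∘ W = id` then `x + W x` lies in the `+1` part. -/
lemma add_apply_mem_plusPart {W : M →ₗ[R] M} (hW : W ∘ₗ W = LinearMap.id) (x : M) :
    x + W x ∈ plusPart W := by
  rw [mem_plusPart, map_add]
  have : W (W x) = x := by
    simpa using congrArg (fun (g : M →ₗ[R] M) => g x) hW
  rw [this, add_comm]

/-- If `W ∘ W = id` then `x - W x` lies in the `-1` part. -/
lemma sub_apply_mem_minusPart {W : M →ₗ[R] M} (hW : W ∘ₗ W = LinearMap.id) (x : M) :
    x - W x ∈ minusPart W := by
  rw [mem_minusPart, map_sub]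
  have : W (W x) = x := by
    simpa using congrArg (fun (g : M →ₗ[R] M) => g x) hW
  rw [this, neg_sub]

/-- The sign trick: with `2` a unit, every `x` is the sum of its two sign components,
so a `W`-stable lattice is generated by its `+1` and `-1` parts. -/
theorem eq_sum_sign_parts {W : M →ₗ[R] M} (hW : W ∘ₗ W = LinearMap.id) (h2 : IsUnit (2 : R)) (x : M) :
    ∃ y ∈ plusPart W, ∃ z ∈ minusPart W, x = y + z := by
  obtain ⟨u, hu⟩ := h2
  refine ⟨(↑u⁻¹ : R) • (x + W x), ?_, (↑u⁻¹ : R) • (x - W x), ?_, ?_⟩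
  · exact Submodule.smul_mem _ _ (add_apply_mem_plusPart hW x)
  · exact Submodule.smul_mem _ _ (sub_apply_mem_minusPart hW x)
  · have h : (↑u⁻¹ : R) • (x + W x) + (↑u⁻¹ : R) • (x - W x) = (↑u⁻¹ * 2 : R) • x := by
      rw [← smul_add, mul_smul, two_smul]
      congr 1
      abel
    rw [h, ← hu, Units.inv_mul, one_smul]

/-- The two sign parts meet trivially when `2` is a unit. -/
theorem plusPart_inf_minusPart_eq_bot {W : M →ₗ[R] M} (h2 : IsUnit (2 : R)) :
    plusPart W ⊓ minusPart W = ⊥ := by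
  rw [eq_bot_iff]
  intro x hx
  rw [Submodule.mem_inf, mem_plusPart, mem_minusPart] at hx
  obtain ⟨h₁, h₂⟩ := hx
  have h : (2 : R) • x = 0 := by
    rw [two_smul]
    nth_rewrite 1 [← h₁]
    rw [h₂, neg_add_cancel]
  obtain ⟨u, hu⟩ := h2
  rw [Submodule.mem_bot]
  have := congrArg (fun m => (↑u⁻¹ : R) • m) h
  simpa [← hu, ← mul_smul] using this

/-- VISIBILITY (the statement the census uses, as a Prop to be proved by a crux-plan seat in the modular setting):
a `W`-stable submodule `L` (e.g. the `𝔪`-part of the Néron cotangent lattice) equals the sum of its intersections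
with the two sign parts. -/
def SignSplitting (W : M →ₗ[R] M) (L : Submodule R M) : Prop :=
  L = L ⊓ plusPart W ⊔ L ⊓ minusPart W

theorem signSplitting_of_stable {W : M →ₗ[R] M} (hW : W ∘ₗ W = LinearMap.id) (h2 : IsUnit (2 : R))
    (L : Submodule R M) (hL : ∀ x ∈ L, W x ∈ L) : SignSplitting W L := by
  unfold SignSplitting
  apply le_antisymm
  · intro x hx
    obtain ⟨u, hu⟩ := h2
    have hy : (↑u⁻¹ : R) • (x + W x) ∈ L ⊓ plusPart W :=
      Submodule.mem_inf.mpr ⟨Submodule.smul_mem _ _ (L.add_mem hx (hL x hx)),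
        Submodule.smul_mem _ _ (add_apply_mem_plusPart hW x)⟩
    have hz : (↑u⁻¹ : R) • (x - W x) ∈ L ⊓ minusPart W :=
      Submodule.mem_inf.mpr ⟨Submodule.smul_mem _ _ (L.sub_mem hx (hL x hx)),
        Submodule.smul_mem _ _ (sub_apply_mem_minusPart hW x)⟩
    have hsum : x = (↑u⁻¹ : R) • (x + W x) + (↑u⁻¹ : R) • (x - W x) := by
      have h : (↑u⁻¹ : R) • (x + W x) + (↑u⁻¹ : R) • (x - W x) = (↑u⁻¹ * 2 : R) • x := by
        rw [← smul_add, mul_smul, two_smul]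
        congr 1
        abel
      rw [h, ← hu, Units.inv_mul, one_smul]
    rw [hsum]
    exact Submodule.add_mem_sup hy hz
  · exact sup_le inf_le_left inf_le_left

end Summit.BirchSwinnertonDyer.BirchSwinnertonDyer.Cruxes.EisensteinAdditiveManinResidual.Visibility
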